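import Mathlib
import HarnessLib
import Summits.Ventures.LatticeQCDFlow.Exactness.MetropolisSweepInstances

/-!
# A chain with a Doeblin POWER converges at every time, not only along the power: the Metropolis sweeps converge from every start

HONEST FRAMING: exact (Metropolis-corrected) sampling algorithms for lattice gauge theory;
figures of merit are autocorrelation/cost numbers at stated couplings and volumes; no
continuum-physics claim.

Venture `LatticeQCDFlow` (cell pub-lqcd), topic `Exactness`, FANOUT row 9 (eng-latcore, the
engine's Metropolis sweeps `u1_2d.sweep_metropolis`, `updates.sweep_metropolis`,
`sun_2d.sweep_metropolis`).  NEW WORK of the cell over the tree (`MetropolisSweepErgodic.lean`: the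
`(k+1)`-st power of a sweep is Doeblin; `MetropolisSweepInstances.lean`: the `U(1)` / `SU(2)`
Wilson instances; `RefreshScan.lean`: `uniformlyErgodic_of_minorised`; `InvariantComposition.lean`:
`nHit`).  Nothing here is cited as a fact.  Printed counterpart, NAMED ONLY: Meyn–Tweedie 1993
Thm 16.0.2 (an `m`-skeleton Doeblin chain is uniformly ergodic).

`MetropolisSweepErgodic.lean` / `MetropolisSweepInstances.lean` state convergence THROUGH the Doeblin
power `S^{k+1}` (time sampled at multiples of `k+1`).  Since the bound there holds from EVERY initial
law, it transfers to every time `n = (k+1)t + r` by starting from `μ₀ Sʳ`: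

* §1 (any measurable space) `isProbabilityMeasure_iterate_bind`, **`iterate_bind_nHit`**
  (`(· S^{m})^[t] μ = (· S)^[m t] μ`), **`uniformlyErgodic_of_nHit_minorised`** — if `S` is Markov,
  `S^{m+1}(a, ·) ≥ ε ν` from every `a` (`ν` a probability law) and `π` is an `S`-invariant probability
  law, then `|μ₀ Sⁿ(A) − π(A)| ≤ (1 − ε)^{⌊n/(m+1)⌋}` for EVERY initial law `μ₀`, every `n`, every `A`.
* §2 **`metropolisSweep_converges`** — the compact-group Metropolis sweep of
  `MetropolisSweepErgodic.lean` (covering kicks, pinched weight, `nhit ≥ 1`, scan through every link)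
  satisfies `|μ₀ Sⁿ(A) − (Z⁻¹w·Haar^⊗)(A)| ≤ (1 − ε)^{⌊n/(k+1)⌋}` at EVERY time `n`;
  **`wilson_metropolisSweep_converges`**, **`wilson_u1MetropolisSweep_converges`** (u1_2d, every
  `step > 0`, every `nhit ≥ 1`), **`wilson_su2MetropolisSweep_converges`** (the engine's `SU(2)`
  sweep, every kick size, every `nhit ≥ 1`): `|μ₀ Sⁿ(A) − wilsonMeasure(A)| ≤ (1 − ε)^{⌊n/t⌋}` for some
  `t ≥ 1`, `ε ∈ (0, 1]`, every initial law, every `n`, every `A`.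

NOT CLAIMED: any value of `t` or `ε`.
-/

noncomputable section

namespace Summit.Ventures.LatticeQCDFlow.Exactness

open MeasureTheory ProbabilityTheory Set Function
open Literature.MathematicalPhysics.QuantumFieldTheory
open scoped ENNReal

/-! ## §1 Skeleton Doeblin ⇒ convergence at every time -/

section Skeleton

variable {α : Type*} [MeasurableSpace α] {κ : Kernel α α} [IsMarkovKernel κ]

/-- Iterating a Markov kernel keeps a probability law a probability law. -/
theorem isProbabilityMeasure_iterate_bind (μ : Measure α) [IsProbabilityMeasure μ] :
    ∀ n : ℕ, IsProbabilityMeasure ((fun m : Measure α => m.bind κ)^[n] μ)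
  | 0 => by rw [iterate_zero, id_eq]; infer_instance
  | n + 1 => by
      haveI := isProbabilityMeasure_iterate_bind μ n
      rw [iterate_succ_apply']
      exact ⟨by rw [Measure.bind_apply MeasurableSet.univ (Kernel.aemeasurable _)]; simp⟩

omit [IsMarkovKernel κ] in
/-- Binding with the `m`-th power is binding `m` times. -/
theorem bind_nHit (μ : Measure α) : ∀ m : ℕ, μ.bind (nHit κ m) = (fun m' : Measure α => m'.bind κ)^[m] μ
  | 0 => by
      rw [nHit_zero, iterate_zero, id_eq]
      exact (invariant_id (μ := μ)).def
  | m + 1 => by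
      rw [nHit_succ, iterate_succ_apply', ← bind_nHit μ m]
      exact Measure.comp_assoc.symm

omit [IsMarkovKernel κ] in
/-- **Iterating the power is iterating**: `(· S^{m})^[t] μ = (· S)^[m t] μ`. -/
theorem iterate_bind_nHit (μ : Measure α) (m : ℕ) :
    ∀ t : ℕ, (fun m' : Measure α => m'.bind (nHit κ m))^[t] μ = (fun m' : Measure α => m'.bind κ)^[m * t] μ
  | 0 => by rw [Nat.mul_zero, iterate_zero, iterate_zero]
  | t + 1 => by
      rw [iterate_succ_apply', iterate_bind_nHit μ m t, bind_nHit, ← iterate_add_apply, Nat.mul_succ, Nat.add_comm]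

/-- **A SKELETON-DOEBLIN CHAIN CONVERGES AT EVERY TIME.**  If `S` is Markov, `S^{m+1}(a, ·) ≥ ε ν` from
every state (`ν` a probability law) and `π` is an `S`-invariant probability law, then for every initial
law `μ₀`, every `n` and every set `A`: `|μ₀ Sⁿ(A) − π(A)| ≤ (1 − ε)^{⌊n/(m+1)⌋}`. -/
theorem uniformlyErgodic_of_nHit_minorised {ν : Measure α} [IsProbabilityMeasure ν] {ε : ℝ≥0∞} {m : ℕ}
    (h : ∀ a, ε • ν ≤ nHit κ (m + 1) a) {π : Measure α} [IsProbabilityMeasure π]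
    (hπ : Kernel.Invariant κ π) (μ₀ : Measure α) [IsProbabilityMeasure μ₀] (n : ℕ) (A : Set α) :
    |((fun m' : Measure α => m'.bind κ)^[n] μ₀).real A - π.real A| ≤ (1 - ε.toReal) ^ (n / (m + 1)) := by
  haveI : IsMarkovKernel (nHit κ (m + 1)) := isMarkovKernel_nHit κ _
  haveI := isProbabilityMeasure_iterate_bind (κ := κ) μ₀ (n % (m + 1))
  have hsplit : (fun m' : Measure α => m'.bind κ)^[n] μ₀ =
      (fun m' : Measure α => m'.bind (nHit κ (m + 1)))^[n / (m + 1)]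
        ((fun m' : Measure α => m'.bind κ)^[n % (m + 1)] μ₀) := by
    rw [iterate_bind_nHit, ← iterate_add_apply, Nat.div_add_mod]
  rw [hsplit]
  exact uniformlyErgodic_of_minorised h (invariant_nHit hπ (m + 1)) _ (n / (m + 1)) A

end Skeleton

/-! ## §2 The Metropolis sweeps converge from every start, at every time -/

section Sweep

variable {ι : Type*} [Fintype ι] [DecidableEq ι] {G : Type*} [TopologicalSpace G] [Group G]
  [IsTopologicalGroup G] [CompactSpace G] [MeasurableSpace G] [BorelSpace G] [SecondCountableTopology G]
variable {ν : Measure G} [IsProbabilityMeasure ν] [ν.IsInvInvariant] {w : (ι → G) → ℝ} {m M : ℝ}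

/-- **THE METROPOLIS SWEEP CONVERGES FROM EVERY START, AT EVERY TIME**: under the hypotheses of
`metropolisSweep_uniformlyErgodic` (k kicks of one link cover with constant `δ > 0`, weight pinched
`0 < m ≤ w ≤ M`, `n ≥ 1` hits, scan through every link), with
`ε = (((m/M)^n)^{|L|})^{k+1} δ^{|ι|}`: `|μ₀ Sʳ(A) − (Z⁻¹w·Haar^{⊗ι})(A)| ≤ (1 − ε)^{⌊r/(k+1)⌋}`. -/
theorem metropolisSweep_converges {k : ℕ} {δ : ℝ≥0∞}
    (hcov : ∀ u : G, δ • haarProbability G ≤ nHit (mulWalk ν) k u) (hw : Measurable w) (hm : 0 < m)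
    (hwm : ∀ U, m ≤ w U) (hwM : ∀ U, w U ≤ M) {n : ℕ} (hn : 1 ≤ n) {L : List ι} (hL : ∀ j, j ∈ L)
    (μ₀ : Measure (ι → G)) [IsProbabilityMeasure μ₀] (r : ℕ) (A : Set (ι → G)) :
    |((fun m' : Measure (ι → G) => m'.bind (metropolisSweep ν w n L))^[r] μ₀).real A
        - (gibbsProbability (Measure.pi fun _ : ι => haarProbability G) w).real A| ≤
      (1 - (((ENNReal.ofReal (m / M) ^ n) ^ L.length) ^ (k + 1) * δ ^ Fintype.card ι).toReal) ^ (r / (k + 1)) := by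
  haveI := isMarkovKernel_metropolisSweep ν hw n L
  haveI := isProbabilityMeasure_gibbsProbability (μ := Measure.pi fun _ : ι => haarProbability G) hm hwm hwM
  have hw0 : ∀ U, 0 < w U := fun U => hm.trans_le (hwm U)
  exact uniformlyErgodic_of_nHit_minorised (metropolisSweep_nHit_minorised hcov hw hm hwm hwM hn hL)
    (invariant_gibbsProbability (metropolisSweep_invariant ν hw hw0 n L)) μ₀ r A

end Sweep

section Wilson

variable {d L N : ℕ} {G : Type*} [TopologicalSpace G] [Group G] [IsTopologicalGroup G] [CompactSpace G]
  [MeasurableSpace G] [BorelSpace G] [SecondCountableTopology G] (ρ : G →* Matrix (Fin N) (Fin N) ℂ)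
  {ν : Measure G} [IsProbabilityMeasure ν] [ν.IsInvInvariant]

/-- **ANY COMPACT GROUP, COVERING KICKS: the `e^{−βS_W}` Metropolis sweep converges to the Wilson measure
from every initial law at every time**: `|μ₀ Sʳ(A) − wilsonMeasure(A)| ≤ (1 − ε)^{⌊r/(k+1)⌋}`, `ε ∈ (0, 1]`. -/
theorem wilson_metropolisSweep_converges [NeZero L] (hρ : Continuous ρ) (β : ℝ) {k : ℕ} {δ : ℝ≥0∞}
    (hcov : ∀ u : G, δ • haarProbability G ≤ nHit (mulWalk ν) k u) (hδ : 0 < δ) {n : ℕ} (hn : 1 ≤ n)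
    {Ls : List (Edge d L)} (hLs : ∀ e, e ∈ Ls) :
    ∃ ε : ℝ, 0 < ε ∧ ε ≤ 1 ∧
      ∀ (μ₀ : Measure (GaugeConfig d L G)) [IsProbabilityMeasure μ₀] (r : ℕ) (A : Set (GaugeConfig d L G)),
        |((fun m' : Measure (GaugeConfig d L G) => m'.bind (metropolisSweep ν
              (fun U : GaugeConfig d L G => Real.exp (-β * wilsonAction ρ U)) n Ls))^[r] μ₀).real A
            - (wilsonMeasure (d := d) (L := L) ρ β).real A| ≤ (1 - ε) ^ (r / (k + 1)) := by
  obtain ⟨s₀, hlo, hhi, hwm⟩ := wilsonBoltzmann_pinched (d := d) (L := L) ρ hρ β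
  haveI := isMarkovKernel_metropolisSweep (ι := Edge d L) ν hwm n Ls
  haveI : IsMarkovKernel (nHit (metropolisSweep ν
      (fun U : GaugeConfig d L G => Real.exp (-β * wilsonAction ρ U)) n Ls) (k + 1)) := isMarkovKernel_nHit _ _
  have hmin := metropolisSweep_nHit_minorised (ι := Edge d L) hcov hwm (Real.exp_pos (-s₀)) hlo hhi hn hLs
  set ε : ℝ≥0∞ := ((ENNReal.ofReal (Real.exp (-s₀) / Real.exp s₀) ^ n) ^ Ls.length) ^ (k + 1) *
    δ ^ Fintype.card (Edge d L)
  have hε0 : 0 < ε := metropolisSweep_const_pos (ι := Edge d L) hδ (Real.exp_pos (-s₀)) hlo hhi n Ls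
  have hε1 : ε ≤ 1 := by
    have h := Measure.le_iff'.1 (hmin fun _ => 1) univ
    rwa [Measure.smul_apply, smul_eq_mul, measure_univ, measure_univ, mul_one] at h
  have hεtop : ε ≠ ⊤ := ne_top_of_le_ne_top ENNReal.one_ne_top hε1
  refine ⟨ε.toReal, ENNReal.toReal_pos hε0.ne' hεtop,
    ENNReal.toReal_le_of_le_ofReal zero_le_one (by rwa [ENNReal.ofReal_one]), fun μ₀ _ r A => ?_⟩
  have h := metropolisSweep_converges (ι := Edge d L) hcov hwm (Real.exp_pos (-s₀)) hlo hhi hn hLs μ₀ r A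
  rw [gibbsProbability_eq_wilsonMeasure] at h
  exact h

end Wilson

section Engines

variable {d L N : ℕ}

/-- **u1_2d `sweep_metropolis` AT EVERY `step > 0` AND `nhit ≥ 1` CONVERGES TO THE `U(1)` WILSON MEASURE
FROM EVERY START, AT EVERY TIME**: `|μ₀ Sʳ(A) − wilsonMeasure(A)| ≤ (1 − ε)^{⌊r/t⌋}` for some `t ≥ 1`,
`ε ∈ (0, 1]` (torus `(ℤ/L)^d`, continuous `ρ`, any `β`, any scan through all edges). -/
theorem wilson_u1MetropolisSweep_converges (ρ : Circle →* Matrix (Fin N) (Fin N) ℂ) [NeZero L]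
    (hρ : Continuous ρ) (β : ℝ) {s : ℝ} (hs : 0 < s) {n : ℕ} (hn : 1 ≤ n) {Ls : List (Edge d L)}
    (hLs : ∀ e, e ∈ Ls) :
    ∃ t : ℕ, 1 ≤ t ∧ ∃ ε : ℝ, 0 < ε ∧ ε ≤ 1 ∧
      ∀ (μ₀ : Measure (GaugeConfig d L Circle)) [IsProbabilityMeasure μ₀] (r : ℕ) (A : Set (GaugeConfig d L Circle)),
        |((fun m' : Measure (GaugeConfig d L Circle) => m'.bind (u1MetropolisSweep s
              (fun U : GaugeConfig d L Circle => Real.exp (-β * wilsonAction ρ U)) n Ls))^[r] μ₀).real A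
            - (wilsonMeasure (d := d) (L := L) ρ β).real A| ≤ (1 - ε) ^ (r / t) := by
  obtain ⟨k, δ, hδ, hcov⟩ := exists_u1Kick_cover hs
  haveI := isProbabilityMeasure_u1KickLaw hs
  haveI := isInvInvariant_u1KickLaw s
  obtain ⟨ε, hε0, hε1, h⟩ := wilson_metropolisSweep_converges (d := d) (L := L) ρ hρ β hcov hδ hn hLs
  exact ⟨k + 1, Nat.succ_pos k, ε, hε0, hε1, h⟩

/-- **THE ENGINE'S `SU(2)` METROPOLIS SWEEP CONVERGES TO THE `SU(2)` WILSON MEASURE FROM EVERY START, AT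
EVERY TIME** (every kick size `s > 0`, every `nhit ≥ 1`, any scan through all edges, continuous `ρ`,
any `β`): `|μ₀ Sʳ(A) − wilsonMeasure(A)| ≤ (1 − ε)^{⌊r/t⌋}` for some `t ≥ 1`, `ε ∈ (0, 1]`. -/
theorem wilson_su2MetropolisSweep_converges (ρ : Matrix.specialUnitaryGroup (Fin 2) ℂ →* Matrix (Fin N) (Fin N) ℂ)
    [NeZero L] (hρ : Continuous ρ) (β : ℝ) {s : ℝ} [Fact (0 < s)] {n : ℕ} (hn : 1 ≤ n)
    {Ls : List (Edge d L)} (hLs : ∀ e, e ∈ Ls) :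
    ∃ t : ℕ, 1 ≤ t ∧ ∃ ε : ℝ, 0 < ε ∧ ε ≤ 1 ∧
      ∀ (μ₀ : Measure (GaugeConfig d L (Matrix.specialUnitaryGroup (Fin 2) ℂ))) [IsProbabilityMeasure μ₀]
        (r : ℕ) (A : Set (GaugeConfig d L (Matrix.specialUnitaryGroup (Fin 2) ℂ))),
        |((fun m' : Measure (GaugeConfig d L (Matrix.specialUnitaryGroup (Fin 2) ℂ)) =>
              m'.bind (metropolisSweep (su2MetropolisKick s)
                (fun U : GaugeConfig d L (Matrix.specialUnitaryGroup (Fin 2) ℂ) =>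
                  Real.exp (-β * wilsonAction ρ U)) n Ls))^[r] μ₀).real A
            - (wilsonMeasure (d := d) (L := L) ρ β).real A| ≤ (1 - ε) ^ (r / t) := by
  obtain ⟨k, δ, hδ, hcov⟩ := exists_su2MetropolisKick_cover (s := s)
  obtain ⟨ε, hε0, hε1, h⟩ := wilson_metropolisSweep_converges (d := d) (L := L) ρ hρ β hcov hδ hn hLs
  exact ⟨k + 1, Nat.succ_pos k, ε, hε0, hε1, h⟩

end Engines

end Summit.Ventures.LatticeQCDFlow.Exactness
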